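import Mathlib
import HarnessLib
import Literature.Analysis.Calculus.AnalyticOfFDerivBound
import Summits.NavierStokesRegularity.NavierStokesRegularity.Theorems.PoloidalWindowDoorLrcModEntireRidgeGlobalBranchLocal

/-!
# Item `LrcModEntire` (stmt-NavierStokesRegularity-20428), registry twist_split v8 — THE FLAT LEVER, rung (F-H): the fourth-order expansion at a FLAT critical point
LEAD of item 20428 ns-poloidal-K2-p3 g15 (`--supports stmt-NavierStokesRegularity-20428 --as helper`).  Memo `Cruxes/LrcModEntire/T2B-g15.md` §17.  The flat twin of
`…RidgeTaylor.ridgeExpansion_of_contDiff` (κ > 0 lever, cubic remainder): CLASS-FREE calculus for `f : E → ℝ` smooth with a global bound `‖D⁵f‖ ≤ C₅` (`iteratedFDeriv` form —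
(F1)/KNSS for a slice of a class profile) at a point `y` where the first three derivatives vanish (every hot point of the FLAT sub-cell `stub_T2bFlat`: `…TwistingTHHotPointPins.gradPin_of_hotPoint`,
`…TwistingTHFlatRidgeJet.hessian_eq_zero_of_flatHotPoint`, `…TwistingTHFlatRidgeCubic.cubic_eq_zero_of_flatHotPoint`):
* `quarticExpansion_of_flatPoint` — `|f(y + Δ) − f(y) − D⁴f(y)[Δ,Δ,Δ,Δ]/24| ≤ (C₅/24)‖Δ‖⁵` for every `Δ` (Taylor–Lagrange on the segment via Mathlib's `taylor_mean_remainder_bound`,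
  derivatives along the line = `Literature.Analysis.Calculus.iteratedDeriv_comp_line`);
* `quarticExpansion_of_flatPoint'` / `quarticRidgeExpansion_of_flatJets` — DIAGONAL hypotheses only (`Dᵏf(y)[Δ,…,Δ] = 0`, k ≤ 3), resp. the form used by the binder-level
  chain on `ℝ³`: `Df(y) = 0`, vanishing Hessian diagonal and vanishing cubic diagonal in the nested currencies of `…FlatRidgeJet` / `…FlatRidgeCubic`;
* `quarticRidgeExpansion_of_flatPoint` — the two-variable form that IS the hypothesis `hH` of `…TwistingTHFlatLever.abs_sSup_sub_le_of_quarticRidgeExpansion'`: with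
  `Q(n,z) := −D⁴f(y)[(nν+ze)⁴]/24` (`‖ν‖, ‖e‖ ≤ 1`), `|f(y + nν + ze) − (f(y) − Q(n,z))| ≤ (C₅/24)(|n|+|z|)⁵`, and `Q(ηt,t) = t⁴Q(η,1)` (`quartic_homogeneous`, multilinearity).
WHAT THIS IS NOT: not a claim about Navier–Stokes regularity and not a proof of `stub_T2bFlat` — a class-free rung of the flat lever (bears_on LADDER-NS N0, item 20428 / crux 19708;
OPEN, ⟨27893⟩ OPEN).
-/

set_option linter.style.longLine false
-- the summit and its single sub-problem share the name (CONVENTIONS §1), as in every Theorems file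
set_option linter.dupNamespace false

namespace Summit.NavierStokesRegularity.NavierStokesRegularity.Theorems.PoloidalWindowDoorLrcModEntireTwistingTHFlatTaylor

open Set Filter Topology
open scoped ContDiff

variable {E : Type*} [NormedAddCommGroup E] [NormedSpace ℝ E]

/-- **The fourth-order expansion at a flat critical point.**  `f ∈ C^∞(E)`, `‖D⁵f‖ ≤ C₅`, `Df(y) = 0`, `D²f(y) = 0`, `D³f(y) = 0` (as `iteratedFDeriv`s):
`|f(y + Δ) − f(y) − D⁴f(y)[Δ,…,Δ]/24| ≤ (C₅/24)‖Δ‖⁵`. -/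
theorem quarticExpansion_of_flatPoint {f : E → ℝ} (hf : ContDiff ℝ ∞ f) {C₅ : ℝ} (hC₅ : ∀ x, ‖iteratedFDeriv ℝ 5 f x‖ ≤ C₅)
    {y : E} (h1 : iteratedFDeriv ℝ 1 f y = 0) (h2 : iteratedFDeriv ℝ 2 f y = 0) (h3 : iteratedFDeriv ℝ 3 f y = 0) (Δ : E) :
    |f (y + Δ) - f y - (1 / 24) * iteratedFDeriv ℝ 4 f y (fun _ => Δ)| ≤ C₅ / 24 * ‖Δ‖ ^ 5 := by
  -- the scalar path
  set φ : ℝ → ℝ := fun τ => f (y + τ • Δ) with hφ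
  have hφs : ContDiff ℝ ∞ φ := hf.comp (contDiff_const.add (contDiff_id.smul contDiff_const))
  have hline : ∀ (k : ℕ) (τ : ℝ), iteratedDeriv k φ τ = iteratedFDeriv ℝ k f (y + τ • Δ) fun _ => Δ := fun k τ =>
    Literature.Analysis.Calculus.iteratedDeriv_comp_line isOpen_univ hf.contDiffOn y Δ (mem_univ _) k
  have hU : UniqueDiffOn ℝ (Icc (0:ℝ) 1) := uniqueDiffOn_Icc zero_lt_one
  have hwithin : ∀ (k : ℕ), ∀ τ ∈ Icc (0:ℝ) 1, iteratedDerivWithin k φ (Icc 0 1) τ = iteratedDeriv k φ τ := fun k τ hτ =>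
    iteratedDerivWithin_eq_iteratedDeriv hU (hφs.contDiffAt.of_le (by exact_mod_cast le_top)) hτ
  -- fifth-derivative bound along the segment
  have hb : ∀ τ ∈ Icc (0:ℝ) 1, ‖iteratedDerivWithin 5 φ (Icc 0 1) τ‖ ≤ C₅ * ‖Δ‖ ^ 5 := by
    intro τ hτ
    rw [hwithin 5 τ hτ]
    have h := Literature.Analysis.Calculus.norm_iteratedDeriv_comp_line_le isOpen_univ hf.contDiffOn y Δ (mem_univ (y + τ • Δ)) 5
    exact h.trans (mul_le_mul_of_nonneg_right (hC₅ _) (by positivity))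
  have hφ5 : ContDiff ℝ 5 φ := hφs.of_le (by norm_cast)
  have htaylor := taylor_mean_remainder_bound (f := φ) (a := 0) (b := 1) (n := 4) zero_le_one
    hφ5.contDiffOn (right_mem_Icc.2 zero_le_one) hb
  -- the Taylor polynomial at `0`: only the orders 0 and 4 survive
  have hT : taylorWithinEval φ 4 (Icc 0 1) 0 1 = f y + (1 / 24) * iteratedFDeriv ℝ 4 f y (fun _ => Δ) := by
    rw [taylor_within_apply]
    simp only [Finset.sum_range_succ, Finset.sum_range_zero, sub_zero, one_pow, mul_one, smul_eq_mul, zero_add]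
    have h0m : (0:ℝ) ∈ Icc (0:ℝ) 1 := left_mem_Icc.2 zero_le_one
    rw [hwithin 0 0 h0m, hwithin 1 0 h0m, hwithin 2 0 h0m, hwithin 3 0 h0m, hwithin 4 0 h0m, hline 1, hline 2, hline 3, hline 4,
      iteratedDeriv_zero]
    simp only [zero_smul, add_zero, h1, h2, h3, zero_apply, mul_zero]
    simp [hφ]
    norm_num
  have hφ1 : φ 1 = f (y + Δ) := by simp [hφ]
  rw [hT, hφ1] at htaylor
  have e : C₅ * ‖Δ‖ ^ 5 * (1 - 0) ^ (4 + 1) / ((4:ℕ).factorial : ℝ) = C₅ / 24 * ‖Δ‖ ^ 5 := by norm_num [Nat.factorial]; ring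
  rw [e, Real.norm_eq_abs] at htaylor
  have e2 : f (y + Δ) - (f y + 1 / 24 * iteratedFDeriv ℝ 4 f y fun _ => Δ) = f (y + Δ) - f y - 1 / 24 * iteratedFDeriv ℝ 4 f y fun _ => Δ := by ring
  rw [e2] at htaylor
  exact htaylor

/-- Degree-4 homogeneity of `t ↦ D⁴f(y)[(t•w)⁴]` (multilinearity). -/
theorem iteratedFDeriv_four_smul (f : E → ℝ) (y w : E) (t : ℝ) :
    iteratedFDeriv ℝ 4 f y (fun _ => t • w) = t ^ 4 * iteratedFDeriv ℝ 4 f y (fun _ => w) := by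
  have h := (iteratedFDeriv ℝ 4 f y).map_smul_univ (fun _ => t) (fun _ => w)
  rw [h]
  simp [Finset.prod_const, smul_eq_mul]

/-- **The quartic form of the flat lever is homogeneous:** `Q(n,z) := −D⁴f(y)[(nν+ze)⁴]/24` satisfies `Q(ηt, t) = t⁴Q(η,1)` — hypothesis `hhom` of
`…TwistingTHFlatLever.abs_sSup_sub_le_of_quarticRidgeExpansion'`. -/
theorem quartic_homogeneous (f : E → ℝ) (y ν e : E) {Q : ℝ → ℝ → ℝ}
    (hQ : ∀ n z, Q n z = -(1 / 24) * iteratedFDeriv ℝ 4 f y (fun _ => n • ν + z • e)) (η t : ℝ) :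
    Q (η * t) t = t ^ 4 * Q η 1 := by
  rw [hQ, hQ]
  have e1 : (η * t) • ν + t • e = t • (η • ν + (1:ℝ) • e) := by rw [smul_add, smul_smul, one_smul, mul_comm]
  rw [e1, iteratedFDeriv_four_smul]
  ring

/-- **(F-H) THE QUARTIC RIDGE EXPANSION AT A FLAT CRITICAL POINT.**  `f ∈ C^∞(E)`, `‖D⁵f‖ ≤ C₅`, the first three derivatives of `f` vanish at `y`, `‖ν‖, ‖e‖ ≤ 1`,
`Q(n,z) := −D⁴f(y)[(nν+ze)⁴]/24`: `|f(y + nν + ze) − (f(y) − Q(n,z))| ≤ (C₅/24)(|n|+|z|)⁵` for all real `n, z` — exactly the hypothesis `hH` of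
`…TwistingTHFlatLever.abs_sSup_sub_le_of_quarticRidgeExpansion'` (with `N = f y`, `C = C₅/24`, any `r`, `δ`). -/
theorem quarticRidgeExpansion_of_flatPoint {f : E → ℝ} (hf : ContDiff ℝ ∞ f) {C₅ : ℝ} (hC₅ : ∀ x, ‖iteratedFDeriv ℝ 5 f x‖ ≤ C₅)
    {y : E} (h1 : iteratedFDeriv ℝ 1 f y = 0) (h2 : iteratedFDeriv ℝ 2 f y = 0) (h3 : iteratedFDeriv ℝ 3 f y = 0)
    {ν e : E} (hν : ‖ν‖ ≤ 1) (he : ‖e‖ ≤ 1) {Q : ℝ → ℝ → ℝ}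
    (hQ : ∀ n z, Q n z = -(1 / 24) * iteratedFDeriv ℝ 4 f y (fun _ => n • ν + z • e)) (n z : ℝ) :
    |f (y + n • ν + z • e) - (f y - Q n z)| ≤ C₅ / 24 * (|n| + |z|) ^ 5 := by
  have h := quarticExpansion_of_flatPoint hf hC₅ h1 h2 h3 (n • ν + z • e)
  have hC0 : 0 ≤ C₅ := (norm_nonneg _).trans (hC₅ y)
  have hΔle : ‖n • ν + z • e‖ ≤ |n| + |z| := by
    refine (norm_add_le _ _).trans (add_le_add ?_ ?_)
    · rw [norm_smul, Real.norm_eq_abs]; exact mul_le_of_le_one_right (abs_nonneg _) hν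
    · rw [norm_smul, Real.norm_eq_abs]; exact mul_le_of_le_one_right (abs_nonneg _) he
  have h5 : ‖n • ν + z • e‖ ^ 5 ≤ (|n| + |z|) ^ 5 := pow_le_pow_left₀ (norm_nonneg _) hΔle 5
  have e1 : f (y + n • ν + z • e) - (f y - Q n z) = f (y + (n • ν + z • e)) - f y - 1 / 24 * iteratedFDeriv ℝ 4 f y (fun _ => n • ν + z • e) := by
    rw [hQ, add_assoc]; ring
  rw [e1]
  exact h.trans (mul_le_mul_of_nonneg_left h5 (by positivity))

/-! ### Diagonal form: only the path derivatives `Dᵏf(y)[Δ,…,Δ]`, `k ≤ 3`, need to vanish -/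

/-- **The fourth-order expansion, diagonal hypotheses.**  As `quarticExpansion_of_flatPoint`, assuming only `Dᵏf(y)[Δ,…,Δ] = 0` for `k = 1,2,3` and the given `Δ`. -/
theorem quarticExpansion_of_flatPoint' {f : E → ℝ} (hf : ContDiff ℝ ∞ f) {C₅ : ℝ} (hC₅ : ∀ x, ‖iteratedFDeriv ℝ 5 f x‖ ≤ C₅)
    {y : E} (Δ : E) (h1 : iteratedFDeriv ℝ 1 f y (fun _ => Δ) = 0) (h2 : iteratedFDeriv ℝ 2 f y (fun _ => Δ) = 0)
    (h3 : iteratedFDeriv ℝ 3 f y (fun _ => Δ) = 0) :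
    |f (y + Δ) - f y - (1 / 24) * iteratedFDeriv ℝ 4 f y (fun _ => Δ)| ≤ C₅ / 24 * ‖Δ‖ ^ 5 := by
  set φ : ℝ → ℝ := fun τ => f (y + τ • Δ) with hφ
  have hφs : ContDiff ℝ ∞ φ := hf.comp (contDiff_const.add (contDiff_id.smul contDiff_const))
  have hline : ∀ (k : ℕ) (τ : ℝ), iteratedDeriv k φ τ = iteratedFDeriv ℝ k f (y + τ • Δ) fun _ => Δ := fun k τ =>
    Literature.Analysis.Calculus.iteratedDeriv_comp_line isOpen_univ hf.contDiffOn y Δ (mem_univ _) k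
  have hU : UniqueDiffOn ℝ (Icc (0:ℝ) 1) := uniqueDiffOn_Icc zero_lt_one
  have hwithin : ∀ (k : ℕ), ∀ τ ∈ Icc (0:ℝ) 1, iteratedDerivWithin k φ (Icc 0 1) τ = iteratedDeriv k φ τ := fun k τ hτ =>
    iteratedDerivWithin_eq_iteratedDeriv hU (hφs.contDiffAt.of_le (by exact_mod_cast le_top)) hτ
  have hb : ∀ τ ∈ Icc (0:ℝ) 1, ‖iteratedDerivWithin 5 φ (Icc 0 1) τ‖ ≤ C₅ * ‖Δ‖ ^ 5 := by
    intro τ hτ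
    rw [hwithin 5 τ hτ]
    have h := Literature.Analysis.Calculus.norm_iteratedDeriv_comp_line_le isOpen_univ hf.contDiffOn y Δ (mem_univ (y + τ • Δ)) 5
    exact h.trans (mul_le_mul_of_nonneg_right (hC₅ _) (by positivity))
  have hφ5 : ContDiff ℝ 5 φ := hφs.of_le (by norm_cast)
  have htaylor := taylor_mean_remainder_bound (f := φ) (a := 0) (b := 1) (n := 4) zero_le_one
    hφ5.contDiffOn (right_mem_Icc.2 zero_le_one) hb
  have hT : taylorWithinEval φ 4 (Icc 0 1) 0 1 = f y + (1 / 24) * iteratedFDeriv ℝ 4 f y (fun _ => Δ) := by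
    rw [taylor_within_apply]
    simp only [Finset.sum_range_succ, Finset.sum_range_zero, sub_zero, one_pow, mul_one, smul_eq_mul, zero_add]
    have h0m : (0:ℝ) ∈ Icc (0:ℝ) 1 := left_mem_Icc.2 zero_le_one
    rw [hwithin 0 0 h0m, hwithin 1 0 h0m, hwithin 2 0 h0m, hwithin 3 0 h0m, hwithin 4 0 h0m, hline 1, hline 2, hline 3, hline 4,
      iteratedDeriv_zero]
    simp only [zero_smul, add_zero, h1, h2, h3, mul_zero]
    simp [hφ]
    norm_num
  have hφ1 : φ 1 = f (y + Δ) := by simp [hφ]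
  rw [hT, hφ1] at htaylor
  have e : C₅ * ‖Δ‖ ^ 5 * (1 - 0) ^ (4 + 1) / ((4:ℕ).factorial : ℝ) = C₅ / 24 * ‖Δ‖ ^ 5 := by norm_num [Nat.factorial]; ring
  rw [e, Real.norm_eq_abs] at htaylor
  have e2 : f (y + Δ) - (f y + 1 / 24 * iteratedFDeriv ℝ 4 f y fun _ => Δ) = f (y + Δ) - f y - 1 / 24 * iteratedFDeriv ℝ 4 f y fun _ => Δ := by ring
  rw [e2] at htaylor
  exact htaylor

/-- **(F-H′) THE QUARTIC RIDGE EXPANSION AT A FLAT HOT POINT of a function on `ℝ³`** — the form the binder-level flat chain uses: `f ∈ C^∞` with `‖D⁵f‖ ≤ C₅`, a point `y`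
with `Df(y) = 0`, VANISHING HESSIAN DIAGONAL (`D²f(y)[w,w] = 0`: the flat sub-cell, `…TwistingTHFlatRidgeJet.hessian_eq_zero_of_flatHotPoint`) and vanishing CUBIC DIAGONAL in the
nested currency of `…TwistingTHFlatRidgeCubic.cubic_eq_zero_of_flatHotPoint` (`D²(x ↦ Df(x)[w])(y)[w,w] = 0`); then `|f(y + nν + ze) − (f(y) − Q(n,z))| ≤ (C₅/24)(|n|+|z|)⁵` with
`Q(n,z) := −D⁴f(y)[(nν+ze)⁴]/24`. -/
theorem quarticRidgeExpansion_of_flatJets {f : EuclideanSpace ℝ (Fin 3) → ℝ} (hf : ContDiff ℝ ∞ f) {C₅ : ℝ}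
    (hC₅ : ∀ x, ‖iteratedFDeriv ℝ 5 f x‖ ≤ C₅) {y : EuclideanSpace ℝ (Fin 3)} (h1 : fderiv ℝ f y = 0)
    (h2 : ∀ w, fderiv ℝ (fderiv ℝ f) y w w = 0) (h3 : ∀ w, fderiv ℝ (fderiv ℝ (fun x => fderiv ℝ f x w)) y w w = 0)
    {ν e : EuclideanSpace ℝ (Fin 3)} (hν : ‖ν‖ ≤ 1) (he : ‖e‖ ≤ 1) {Q : ℝ → ℝ → ℝ}
    (hQ : ∀ n z, Q n z = -(1 / 24) * iteratedFDeriv ℝ 4 f y (fun _ => n • ν + z • e)) (n z : ℝ) :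
    |f (y + n • ν + z • e) - (f y - Q n z)| ≤ C₅ / 24 * (|n| + |z|) ^ 5 := by
  have hf3 : ContDiff ℝ 3 f := hf.of_le (by norm_cast)
  set Δ : EuclideanSpace ℝ (Fin 3) := n • ν + z • e with hΔ
  -- the three diagonal path derivatives vanish
  have hd1 : iteratedFDeriv ℝ 1 f y (fun _ => Δ) = 0 := by
    rw [iteratedFDeriv_one_apply, h1]; rfl
  have hd2 : iteratedFDeriv ℝ 2 f y (fun _ => Δ) = 0 := by
    rw [iteratedFDeriv_two_apply]; exact h2 Δ
  have hd3 : iteratedFDeriv ℝ 3 f y (fun _ => Δ) = 0 := by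
    have hvec : (fun _ : Fin 3 => Δ) = ![Δ, Δ, Δ] := by funext i; fin_cases i <;> rfl
    rw [hvec, ← Summit.NavierStokesRegularity.NavierStokesRegularity.Theorems.PoloidalWindowDoorLrcModEntireRidgeGlobalBranchLocal.fderiv_fderiv_fderiv_apply_const hf3]
    exact h3 Δ
  have h := quarticExpansion_of_flatPoint' hf hC₅ Δ hd1 hd2 hd3
  have hC0 : 0 ≤ C₅ := (norm_nonneg _).trans (hC₅ y)
  have hΔle : ‖Δ‖ ≤ |n| + |z| := by
    rw [hΔ]
    refine (norm_add_le _ _).trans (add_le_add ?_ ?_)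
    · rw [norm_smul, Real.norm_eq_abs]; exact mul_le_of_le_one_right (abs_nonneg _) hν
    · rw [norm_smul, Real.norm_eq_abs]; exact mul_le_of_le_one_right (abs_nonneg _) he
  have h5 : ‖Δ‖ ^ 5 ≤ (|n| + |z|) ^ 5 := pow_le_pow_left₀ (norm_nonneg _) hΔle 5
  have e1 : f (y + n • ν + z • e) - (f y - Q n z) = f (y + Δ) - f y - 1 / 24 * iteratedFDeriv ℝ 4 f y (fun _ => Δ) := by
    rw [hQ, hΔ, add_assoc]; ring
  rw [e1]
  exact h.trans (mul_le_mul_of_nonneg_left h5 (by positivity))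

end Summit.NavierStokesRegularity.NavierStokesRegularity.Theorems.PoloidalWindowDoorLrcModEntireTwistingTHFlatTaylor
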